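import Summits.KontsevichZagierPeriods.Zeta5Search.Certificates.TwoTaleOmegaRuleLegit
import Summits.KontsevichZagierPeriods.Zeta5Search.Certificates.TwoTaleOmegaBaseQ

/-!
# ζ(2) two-tale line — the BASE of the Ω-induction is exactly the 1908-point table (cell `pub-zeta5`, certifier `cert-2`, gen 5)

HONEST FRAMING: systematic search; recurrence certificates; no irrationality claim unless certified.

`TwoTaleOmegaRuleLegit.eq_on_Omega_rule` runs fam-tele's Ω-induction (`certs/tele/bmiss_general/PROOF.md` §1, §5) for the RULE legitimacy
predicate `LegitSet Cert`; with every rule step certified (`Cert := univ`; the tree now has the analytic step for all seven directions but `aef`,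
and takes `a`/`aef` steps for targets with `a ≥ 17` only) its BASE is `{p ∈ Ω : no rule applies} ∪ {p ∈ Ω : rule ∈ {a, aef}, a ≤ 16}`.
`TwoTaleOmegaRuleLegit.base_cases` only places it inside the box `3 ≤ a ≤ 16, b ≤ 2a+7, …` (264 796 points of `Ω`).  This file pins it down:
**`base_cases_table`** — every base point is one of the 1908 points of `TwoTaleOmegaBaseQ.baseTab0..3 ∪ baseTabOdd` (the table on which
the tree's `baseQ_all` / `baseTabOdd_q` / `TwoTaleOmegaBaseP0..7` check `q = −q̂`, `p = −p̂`).  Proof: a base point has `a ≤ 16`, rules `g, b, e, f`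
inapplicable and (`a` or `aef` applicable, or `bg` inapplicable) (`base_facts`); linear arithmetic then gives `a+1 ≤ g ≤ a+6`, `b ≤ a − min(e,f) + 3`
(`base_bounds`); the finitely many lattice points of that shape are enumerated in lexicographic order (`candsA`, a computable list per `a`) and one kernel
`decide` per `a` checks that those satisfying the Boolean mirror of the base conditions are exactly the table points with that `a`, the table being
merged into lexicographic order first (`candsA_filter_3 … candsA_filter_16`; a fuel-bounded structural merge, since well-founded `List.mergeSort` does not evaluate in the kernel).
Linear arithmetic and list bookkeeping only; nothing analytic is proved here.
-/

namespace Summit.KontsevichZagierPeriods.Zeta5Search.Certificates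

namespace TwoTaleTelescope

open Finset

/-! ### The certified-rule legitimacy predicate and the shape of its base -/

/-- The certificate predicate of the final assembly: EVERY rule step is certified (the tree proves the analytic step of each direction on the
whole rule domain).  The legitimacy predicate is then `fun δ p₀ => p₀ ∈ LegitSet CertU δ`: RULE steps (first applicable direction in the order
g, b, e, f, a, aef, bg), `a`/`aef` steps only for targets with `a ≥ 17`. -/
def CertU : Pt → Set Pt := fun _ => Set.univ

/-- A rule step whose target has `a ≥ 17` when `δ ∈ {a, aef}` is a certified step for the legitimacy predicate of `CertU`. -/
theorem stepBase_of_ruleDom {δ p : Pt} (hδ : δ ∈ dirs) (hr : p ∈ RuleDom δ) (h17 : (δ = dirA ∨ δ = dirAEF) → 17 ≤ p 0) :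
    p - (3 : ℤ) • δ ∈ StepBase (fun δ p₀ => p₀ ∈ LegitSet CertU δ) δ := by
  have happ : p ∈ App δ := app_of_ruleDom hδ hr
  have h0 := ((mem_App_iff_stepBase δ hδ p).mp happ)
  refine ⟨hδ, h0.2.1, ?_⟩
  show p - (3 : ℤ) • δ ∈ LegitSet CertU δ
  refine ⟨by rw [sub_add_cancel]; exact hr, Set.mem_univ _, fun hd => ?_⟩
  rw [sub_add_cancel]; exact h17 hd

/-- Rule `bg` inapplicable ⇒ `b ≤ 3 ∨ b+e ≤ a+3 ∨ b+f ≤ a+3 ∨ g ≤ a+3`. -/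
theorem not_app_BG (p : Pt) (hp : p ∈ Omega) (h : p ∉ App dirBG) :
    p 1 ≤ 3 ∨ p 1 + p 2 ≤ p 0 + 3 ∨ p 1 + p 3 ≤ p 0 + 3 ∨ p 4 ≤ p 0 + 3 := by
  simp only [App, Set.mem_setOf_eq, not_forall] at h
  obtain ⟨k, hk, hn⟩ := h
  rw [mem_Omega] at hp hn
  have e0 : (p - (k : ℤ) • dirBG) 0 = p 0 := by simp [dirBG]
  have e1 : (p - (k : ℤ) • dirBG) 1 = p 1 - k := by simp [dirBG]
  have e2 : (p - (k : ℤ) • dirBG) 2 = p 2 := by simp [dirBG]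
  have e3 : (p - (k : ℤ) • dirBG) 3 = p 3 := by simp [dirBG]
  have e4 : (p - (k : ℤ) • dirBG) 4 = p 4 - k := by simp [dirBG]
  rw [e0, e1, e2, e3, e4] at hn
  have hk' : (k : ℤ) ≤ 3 := by exact_mod_cast hk
  omega

/-- Rule `aef` applicable ⇒ `e, f ≥ 4`, `2e ≥ a+4`, `2f ≥ a+4` (from the base point `p − 3·(1,0,1,1,0) ∈ Ω`). -/
theorem app_AEF (p : Pt) (h : p ∈ App dirAEF) : 4 ≤ p 2 ∧ 4 ≤ p 3 ∧ p 0 + 4 ≤ 2 * p 2 ∧ p 0 + 4 ≤ 2 * p 3 := by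
  have h3 := h 3 le_rfl
  rw [mem_Omega] at h3
  obtain ⟨e0, e1, e2, e3, e4⟩ := shift_AEF p ((3 : ℕ) : ℤ)
  rw [e0, e1, e2, e3, e4] at h3
  push_cast at h3
  omega

/-- **Shape of the base, rule form**: a base point (legitimacy predicate of `CertU`) lies in `Ω`, has `a ≤ 16`, rules `g, b, e, f` inapplicable, and either rule `a`
or rule `aef` applicable or rule `bg` inapplicable. -/
theorem base_facts {p : Pt} (h : p ∈ Base (fun δ p₀ => p₀ ∈ LegitSet CertU δ)) :
    p ∈ Omega ∧ p 0 ≤ 16 ∧ p ∉ App dirG ∧ p ∉ App dirB ∧ p ∉ App dirE ∧ p ∉ App dirF ∧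
      (p ∈ App dirA ∨ p ∈ App dirAEF ∨ p ∉ App dirBG) := by
  obtain ⟨hp, hno⟩ := h
  -- no certified rule step reaches `p`
  have key : ∀ δ ∈ dirs, p ∈ RuleDom δ → (δ = dirA ∨ δ = dirAEF) ∧ p 0 ≤ 16 := by
    intro δ hδ hr
    by_contra hcon
    refine hno δ hδ (stepBase_of_ruleDom hδ hr fun hd => ?_)
    by_contra h17
    exact hcon ⟨hd, by omega⟩
  by_cases hex : ∃ δ ∈ dirs, p ∈ App δ
  · obtain ⟨δ, hδ, hr⟩ := exists_ruleDom hex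
    obtain ⟨hd, h16⟩ := key δ hδ hr
    rcases hd with rfl | rfl
    · rw [ruleDom_A] at hr
      obtain ⟨hA, hg, hb, he, hf⟩ := hr
      exact ⟨hp, h16, hg, hb, he, hf, Or.inl hA⟩
    · rw [ruleDom_AEF] at hr
      obtain ⟨hAEF, hg, hb, he, hf, -⟩ := hr
      exact ⟨hp, h16, hg, hb, he, hf, Or.inr (Or.inl hAEF)⟩
  · have hnone : ∀ δ ∈ dirs, p ∉ App δ := fun δ hδ happ => hex ⟨δ, hδ, happ⟩
    have h16 : p 0 ≤ 16 := by
      by_contra h17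
      rcases rule_exists p hp (by omega) with h | h | h | h | h | h
      · exact hnone dirG (by simp [dirs]) h
      · exact hnone dirB (by simp [dirs]) h
      · exact hnone dirE (by simp [dirs]) h
      · exact hnone dirF (by simp [dirs]) h
      · exact hnone dirA (by simp [dirs]) h
      · exact hnone dirAEF (by simp [dirs]) h
    exact ⟨hp, h16, hnone dirG (by simp [dirs]), hnone dirB (by simp [dirs]), hnone dirE (by simp [dirs]), hnone dirF (by simp [dirs]),
      Or.inr (Or.inr (hnone dirBG (by simp [dirs])))⟩

/-- **Bounds on the base**: `3 ≤ a ≤ 16`, `a+1 ≤ g ≤ a+6`, `1 ≤ b ≤ a − min(e,f) + 3`, `(a+2)/2 ≤ e, f ≤ a`. -/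
theorem base_bounds {p : Pt} (h : p ∈ Base (fun δ p₀ => p₀ ∈ LegitSet CertU δ)) :
    3 ≤ p 0 ∧ p 0 ≤ 16 ∧ p 0 + 1 ≤ p 4 ∧ p 4 ≤ p 0 + 6 ∧ 1 ≤ p 1 ∧ (p 1 + p 2 ≤ p 0 + 3 ∨ p 1 + p 3 ≤ p 0 + 3) ∧
      (p 0 + 2) / 2 ≤ p 2 ∧ p 2 ≤ p 0 ∧ (p 0 + 2) / 2 ≤ p 3 ∧ p 3 ≤ p 0 := by
  obtain ⟨hp, h16, hg, hb, -, -, htri⟩ := base_facts h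
  have hG := not_app_G p hp hg
  have hB := not_app_B p hp hb
  have h3 := three_le_a p hp
  rw [mem_Omega] at hp
  rcases htri with hA | hAEF | hBG
  · have := app_A p hA
    omega
  · have := app_AEF p hAEF
    omega
  · have := not_app_BG p (mem_Omega.mpr hp) hBG
    omega

/-! ### Boolean mirrors -/

/-- Integer 5-tuples `(a,b,e,f,g)` (the format of the base tables). -/
abbrev Tup := ℤ × ℤ × ℤ × ℤ × ℤ

/-- The tuple of a point. -/
def toTup (p : Pt) : Tup := (p 0, p 1, p 2, p 3, p 4)

/-- Boolean mirror of membership in `Ω` (conjuncts of `mem_Omega`). -/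
def omegaB (q : Tup) : Bool :=
  decide (1 ≤ q.1) && decide (1 ≤ q.2.1) && decide (1 ≤ q.2.2.1) && decide (1 ≤ q.2.2.2.1) && decide (1 ≤ q.2.2.2.2) &&
  decide (q.1 + 1 ≤ 2 * q.2.2.1) && decide (q.1 + 1 ≤ 2 * q.2.2.2.1) && decide (q.2.2.1 ≤ q.1) && decide (q.2.2.2.1 ≤ q.1) &&
  (decide (q.1 + 3 ≤ 2 * q.2.2.1) || decide (q.1 + 3 ≤ 2 * q.2.2.2.1)) &&
  decide (q.1 + 1 ≤ q.2.1 + q.2.2.1) && decide (q.1 + 1 ≤ q.2.1 + q.2.2.2.1) && decide (q.1 + 1 ≤ q.2.2.2.2) &&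
  decide (q.2.1 + 3 ≤ q.2.2.2.2) && decide (q.2.2.2.2 ≤ 2 * q.2.2.1 + 2 * q.2.2.2.1 + q.2.1 - q.1 - 1)

/-- Componentwise `q − k·δ` on tuples. -/
def tsub (q : Tup) (k : ℤ) (δ : Tup) : Tup :=
  (q.1 - k * δ.1, q.2.1 - k * δ.2.1, q.2.2.1 - k * δ.2.2.1, q.2.2.2.1 - k * δ.2.2.2.1, q.2.2.2.2 - k * δ.2.2.2.2)

/-- Boolean mirror of applicability `App δ` (`p − kδ ∈ Ω` for `k ≤ 3`). -/
def appB (δ q : Tup) : Bool := omegaB q && omegaB (tsub q 1 δ) && omegaB (tsub q 2 δ) && omegaB (tsub q 3 δ)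

/-- Boolean mirror of the base conditions of `base_facts`. -/
def condB (q : Tup) : Bool :=
  omegaB q && decide (q.1 ≤ 16) && !appB (0, 0, 0, 0, 1) q && !appB (0, 1, 0, 0, 0) q && !appB (0, 0, 1, 0, 0) q && !appB (0, 0, 0, 1, 0) q &&
    (appB (1, 0, 0, 0, 0) q || appB (1, 0, 1, 1, 0) q || !appB (0, 1, 0, 0, 1) q)

/-- `omegaB` decides membership in `Ω`. -/
theorem omegaB_toTup (p : Pt) : omegaB (toTup p) = true ↔ p ∈ Omega := by
  rw [mem_Omega]
  simp only [omegaB, toTup, Bool.and_eq_true, Bool.or_eq_true, decide_eq_true_eq]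
  tauto

/-- `tsub` mirrors `p − k • δ`. -/
theorem tsub_toTup (p δ : Pt) (k : ℤ) : tsub (toTup p) k (toTup δ) = toTup (p - k • δ) := by
  simp [tsub, toTup, Pi.sub_apply]

/-- `appB` decides applicability. -/
theorem appB_toTup (δ p : Pt) : appB (toTup δ) (toTup p) = true ↔ p ∈ App δ := by
  simp only [appB, Bool.and_eq_true, tsub_toTup, omegaB_toTup, App, Set.mem_setOf_eq]
  constructor
  · rintro ⟨⟨⟨h0, h1⟩, h2⟩, h3⟩ k hk
    interval_cases k
    · simpa using h0
    · simpa using h1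
    · simpa using h2
    · simpa using h3
  · intro h
    exact ⟨⟨⟨by simpa using h 0 (by norm_num), by simpa using h 1 (by norm_num)⟩, by simpa using h 2 (by norm_num)⟩,
      by simpa using h 3 (by norm_num)⟩

/-- Inapplicability in Boolean form. -/
theorem appB_false_of {δ p : Pt} (h : p ∉ App δ) : appB (toTup δ) (toTup p) = false := by
  cases hb : appB (toTup δ) (toTup p)
  · rfl
  · exact absurd ((appB_toTup δ p).1 hb) h

/-- The tuples of the seven directions. -/
theorem toTup_dirs : toTup dirG = (0, 0, 0, 0, 1) ∧ toTup dirB = (0, 1, 0, 0, 0) ∧ toTup dirE = (0, 0, 1, 0, 0) ∧ toTup dirF = (0, 0, 0, 1, 0) ∧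
    toTup dirA = (1, 0, 0, 0, 0) ∧ toTup dirAEF = (1, 0, 1, 1, 0) ∧ toTup dirBG = (0, 1, 0, 0, 1) := by
  simp [toTup, dirG, dirB, dirE, dirF, dirA, dirAEF, dirBG]

/-- The base conditions of `base_facts` in Boolean form. -/
theorem condB_of_base {p : Pt} (h : p ∈ Base (fun δ p₀ => p₀ ∈ LegitSet CertU δ)) : condB (toTup p) = true := by
  obtain ⟨hp, h16, hg, hb, he, hf, htri⟩ := base_facts h
  obtain ⟨tG, tB, tE, tF, tA, tAEF, tBG⟩ := toTup_dirs
  have eΩ := (omegaB_toTup p).2 hp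
  have d16 : decide ((toTup p).1 ≤ 16) = true := by simp [toTup, h16]
  have eG := appB_false_of hg
  have eB := appB_false_of hb
  have eE := appB_false_of he
  have eF := appB_false_of hf
  rw [tG] at eG; rw [tB] at eB; rw [tE] at eE; rw [tF] at eF
  have tri : (appB (1, 0, 0, 0, 0) (toTup p) || appB (1, 0, 1, 1, 0) (toTup p) || !appB (0, 1, 0, 0, 1) (toTup p)) = true := by
    rw [← tA, ← tAEF, ← tBG]
    rcases htri with hA | hAEF | hBG
    · rw [(appB_toTup _ _).2 hA]; simp
    · rw [(appB_toTup _ _).2 hAEF]; simp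
    · rw [appB_false_of hBG]; simp
  simp only [condB, eΩ, d16, eG, eB, eE, eF, Bool.not_false, Bool.true_and]
  exact tri

/-! ### The enumeration -/

/-- The integer interval `[lo, hi]` as an increasing list (`Int.range lo (hi+1)`). -/
def irange (lo hi : ℤ) : List ℤ := Int.range lo (hi + 1)

/-- Membership in `irange`. -/
theorem mem_irange {lo hi x : ℤ} : x ∈ irange lo hi ↔ lo ≤ x ∧ x ≤ hi := by
  unfold irange; rw [Int.mem_range_iff]; omega

/-- The candidate box of `base_bounds` at a fixed `a`, enumerated in lexicographic order of `(b,e,f,g)`. -/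
def candsA (a : ℤ) : List Tup :=
  (irange 1 (a + 3)).flatMap fun b => (irange ((a + 2) / 2) a).flatMap fun e =>
    (irange ((a + 2) / 2) a).flatMap fun f =>
      if b + e ≤ a + 3 ∨ b + f ≤ a + 3 then (irange (a + 1) (a + 6)).map fun g => (a, b, e, f, g) else []

/-- A base point is a candidate at its own `a`. -/
theorem mem_candsA {p : Pt} (h : p ∈ Base (fun δ p₀ => p₀ ∈ LegitSet CertU δ)) : toTup p ∈ candsA (p 0) := by
  obtain ⟨-, -, hg1, hg6, hb1, hb, he1, he2, hf1, hf2⟩ := base_bounds h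
  simp only [candsA, List.mem_flatMap, mem_irange]
  refine ⟨p 1, ⟨hb1, by omega⟩, p 2, ⟨he1, he2⟩, p 3, ⟨hf1, hf2⟩, ?_⟩
  rw [if_pos hb]
  simp only [List.mem_map, mem_irange]
  exact ⟨p 4, ⟨hg1, hg6⟩, rfl⟩

/-- Lexicographic comparison of tuples (only used to merge the sorted table parts; its correctness is irrelevant to the proofs). -/
def lexLE (p q : Tup) : Bool :=
  decide (p.1 < q.1) || (p.1 == q.1 && (decide (p.2.1 < q.2.1) || (p.2.1 == q.2.1 && (decide (p.2.2.1 < q.2.2.1) ||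
    (p.2.2.1 == q.2.2.1 && (decide (p.2.2.2.1 < q.2.2.2.1) || (p.2.2.2.1 == q.2.2.2.1 && decide (p.2.2.2.2 ≤ q.2.2.2.2))))))))

/-- Fuel-bounded merge of two lists (structural recursion on the fuel, so that the kernel evaluates it). -/
def mergeF {α : Type*} (le : α → α → Bool) : ℕ → List α → List α → List α
  | 0, xs, ys => xs ++ ys
  | n + 1, xs, ys =>
    match xs, ys with
    | [], ys => ys
    | xs, [] => xs
    | x :: xs', y :: ys' => if le x y then x :: mergeF le n xs' (y :: ys') else y :: mergeF le n (x :: xs') ys'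

/-- An element of a merge comes from one of the two lists. -/
theorem mem_mergeF {α : Type*} (le : α → α → Bool) :
    ∀ (n : ℕ) (xs ys : List α) (a : α), a ∈ mergeF le n xs ys → a ∈ xs ∨ a ∈ ys
  | 0, xs, ys, a, h => List.mem_append.1 h
  | n + 1, [], ys, a, h => Or.inr h
  | n + 1, x :: xs', [], a, h => Or.inl h
  | n + 1, x :: xs', y :: ys', a, h => by
    simp only [mergeF] at h
    split_ifs at h with hle
    · rcases List.mem_cons.1 h with rfl | h'
      · exact Or.inl List.mem_cons_self
      · rcases mem_mergeF le n xs' (y :: ys') a h' with h1 | h2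
        · exact Or.inl (List.mem_cons_of_mem _ h1)
        · exact Or.inr h2
    · rcases List.mem_cons.1 h with rfl | h'
      · exact Or.inr List.mem_cons_self
      · rcases mem_mergeF le n (x :: xs') ys' a h' with h1 | h2
        · exact Or.inl h1
        · exact Or.inr (List.mem_cons_of_mem _ h2)

/-- The whole base table of `TwoTaleOmegaBaseQ` (1902 regular points and the 6 points with `d = −1`), merged into lexicographic order. -/
def baseTabSorted : List Tup :=
  mergeF lexLE 2000 (mergeF lexLE 2000 (mergeF lexLE 1000 baseTab0 baseTab1) (mergeF lexLE 1000 baseTab2 baseTab3)) baseTabOdd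

/-- Every entry of the merged table is a table point. -/
theorem mem_baseTabSorted {q : Tup} (h : q ∈ baseTabSorted) :
    q ∈ baseTab0 ++ baseTab1 ++ baseTab2 ++ baseTab3 ∨ q ∈ baseTabOdd := by
  unfold baseTabSorted at h
  simp only [List.mem_append]
  rcases mem_mergeF _ _ _ _ _ h with h | h
  · rcases mem_mergeF _ _ _ _ _ h with h | h
    · rcases mem_mergeF _ _ _ _ _ h with h | h
      · exact Or.inl (Or.inl (Or.inl (Or.inl h)))
      · exact Or.inl (Or.inl (Or.inl (Or.inr h)))
    · rcases mem_mergeF _ _ _ _ _ h with h | h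
      · exact Or.inl (Or.inl (Or.inr h))
      · exact Or.inl (Or.inr h)
  · exact Or.inr h

set_option maxHeartbeats 4000000 in
set_option maxRecDepth 100000 in
/-- The enumeration at `a = 3`: the candidates satisfying the base conditions are exactly the table points with `a = 3` (one kernel evaluation). -/
theorem candsA_filter_3 : (candsA 3).filter condB = baseTabSorted.filter (fun q => q.1 == 3) := by
  decide +kernel

set_option maxHeartbeats 4000000 in
set_option maxRecDepth 100000 in
/-- The enumeration at `a = 4`: the candidates satisfying the base conditions are exactly the table points with `a = 4` (one kernel evaluation). -/
theorem candsA_filter_4 : (candsA 4).filter condB = baseTabSorted.filter (fun q => q.1 == 4) := by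
  decide +kernel

set_option maxHeartbeats 4000000 in
set_option maxRecDepth 100000 in
/-- The enumeration at `a = 5`: the candidates satisfying the base conditions are exactly the table points with `a = 5` (one kernel evaluation). -/
theorem candsA_filter_5 : (candsA 5).filter condB = baseTabSorted.filter (fun q => q.1 == 5) := by
  decide +kernel

set_option maxHeartbeats 4000000 in
set_option maxRecDepth 100000 in
/-- The enumeration at `a = 6`: the candidates satisfying the base conditions are exactly the table points with `a = 6` (one kernel evaluation). -/
theorem candsA_filter_6 : (candsA 6).filter condB = baseTabSorted.filter (fun q => q.1 == 6) := by
  decide +kernel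

set_option maxHeartbeats 4000000 in
set_option maxRecDepth 100000 in
/-- The enumeration at `a = 7`: the candidates satisfying the base conditions are exactly the table points with `a = 7` (one kernel evaluation). -/
theorem candsA_filter_7 : (candsA 7).filter condB = baseTabSorted.filter (fun q => q.1 == 7) := by
  decide +kernel

set_option maxHeartbeats 4000000 in
set_option maxRecDepth 100000 in
/-- The enumeration at `a = 8`: the candidates satisfying the base conditions are exactly the table points with `a = 8` (one kernel evaluation). -/
theorem candsA_filter_8 : (candsA 8).filter condB = baseTabSorted.filter (fun q => q.1 == 8) := by
  decide +kernel

set_option maxHeartbeats 4000000 in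
set_option maxRecDepth 100000 in
/-- The enumeration at `a = 9`: the candidates satisfying the base conditions are exactly the table points with `a = 9` (one kernel evaluation). -/
theorem candsA_filter_9 : (candsA 9).filter condB = baseTabSorted.filter (fun q => q.1 == 9) := by
  decide +kernel

set_option maxHeartbeats 4000000 in
set_option maxRecDepth 100000 in
/-- The enumeration at `a = 10`: the candidates satisfying the base conditions are exactly the table points with `a = 10` (one kernel evaluation). -/
theorem candsA_filter_10 : (candsA 10).filter condB = baseTabSorted.filter (fun q => q.1 == 10) := by
  decide +kernel

set_option maxHeartbeats 4000000 in
set_option maxRecDepth 100000 in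
/-- The enumeration at `a = 11`: the candidates satisfying the base conditions are exactly the table points with `a = 11` (one kernel evaluation). -/
theorem candsA_filter_11 : (candsA 11).filter condB = baseTabSorted.filter (fun q => q.1 == 11) := by
  decide +kernel

set_option maxHeartbeats 4000000 in
set_option maxRecDepth 100000 in
/-- The enumeration at `a = 12`: the candidates satisfying the base conditions are exactly the table points with `a = 12` (one kernel evaluation). -/
theorem candsA_filter_12 : (candsA 12).filter condB = baseTabSorted.filter (fun q => q.1 == 12) := by
  decide +kernel

set_option maxHeartbeats 4000000 in
set_option maxRecDepth 100000 in
/-- The enumeration at `a = 13`: the candidates satisfying the base conditions are exactly the table points with `a = 13` (one kernel evaluation). -/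
theorem candsA_filter_13 : (candsA 13).filter condB = baseTabSorted.filter (fun q => q.1 == 13) := by
  decide +kernel

set_option maxHeartbeats 4000000 in
set_option maxRecDepth 100000 in
/-- The enumeration at `a = 14`: the candidates satisfying the base conditions are exactly the table points with `a = 14` (one kernel evaluation). -/
theorem candsA_filter_14 : (candsA 14).filter condB = baseTabSorted.filter (fun q => q.1 == 14) := by
  decide +kernel

set_option maxHeartbeats 4000000 in
set_option maxRecDepth 100000 in
/-- The enumeration at `a = 15`: the candidates satisfying the base conditions are exactly the table points with `a = 15` (one kernel evaluation). -/
theorem candsA_filter_15 : (candsA 15).filter condB = baseTabSorted.filter (fun q => q.1 == 15) := by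
  decide +kernel

set_option maxHeartbeats 4000000 in
set_option maxRecDepth 100000 in
/-- The enumeration at `a = 16`: the candidates satisfying the base conditions are exactly the table points with `a = 16` (one kernel evaluation). -/
theorem candsA_filter_16 : (candsA 16).filter condB = baseTabSorted.filter (fun q => q.1 == 16) := by
  decide +kernel

/-- **The enumeration**: a base point's tuple lies in the merged table. -/
theorem base_mem_sorted {p : Pt} (h : p ∈ Base (fun δ p₀ => p₀ ∈ LegitSet CertU δ)) : toTup p ∈ baseTabSorted := by
  have hm : toTup p ∈ (candsA (p 0)).filter condB := List.mem_filter.2 ⟨mem_candsA h, condB_of_base h⟩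
  obtain ⟨h3, h16, -⟩ := base_bounds h
  have key : ∀ a : ℤ, 3 ≤ a → a ≤ 16 → toTup p ∈ (candsA a).filter condB → toTup p ∈ baseTabSorted := by
    intro a ha1 ha2 hm
    interval_cases a
    · rw [candsA_filter_3] at hm; exact (List.mem_filter.1 hm).1
    · rw [candsA_filter_4] at hm; exact (List.mem_filter.1 hm).1
    · rw [candsA_filter_5] at hm; exact (List.mem_filter.1 hm).1
    · rw [candsA_filter_6] at hm; exact (List.mem_filter.1 hm).1
    · rw [candsA_filter_7] at hm; exact (List.mem_filter.1 hm).1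
    · rw [candsA_filter_8] at hm; exact (List.mem_filter.1 hm).1
    · rw [candsA_filter_9] at hm; exact (List.mem_filter.1 hm).1
    · rw [candsA_filter_10] at hm; exact (List.mem_filter.1 hm).1
    · rw [candsA_filter_11] at hm; exact (List.mem_filter.1 hm).1
    · rw [candsA_filter_12] at hm; exact (List.mem_filter.1 hm).1
    · rw [candsA_filter_13] at hm; exact (List.mem_filter.1 hm).1
    · rw [candsA_filter_14] at hm; exact (List.mem_filter.1 hm).1
    · rw [candsA_filter_15] at hm; exact (List.mem_filter.1 hm).1
    · rw [candsA_filter_16] at hm; exact (List.mem_filter.1 hm).1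
  exact key (p 0) h3 h16 hm

/-- **The base of the Ω-induction lies in the table**: every base point (legitimacy predicate of `CertU`) is one of the 1908 tabulated points — in
the regular part (`d ≥ 0`, the domain of `baseQ_all` and `TwoTaleOmegaBaseP0..7`) or among the six points with `d = −1` (`baseTabOdd`). -/
theorem base_cases_table {p : Pt} (h : p ∈ Base (fun δ p₀ => p₀ ∈ LegitSet CertU δ)) :
    toTup p ∈ baseTab0 ++ baseTab1 ++ baseTab2 ++ baseTab3 ∨ toTup p ∈ baseTabOdd :=
  mem_baseTabSorted (base_mem_sorted h)

end TwoTaleTelescope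

end Summit.KontsevichZagierPeriods.Zeta5Search.Certificates
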